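import Summits.HodgeConjecture.HodgeConjecture.Theorems.VHCAbelianSchemesRoadSecantAnchorInhabited
import Literature.AlgebraicGeometry.HodgeTheory.WeilTypeAbelianVariety
import Literature.AlgebraicGeometry.HodgeTheory.WeilClassesHodgeType
import Literature.AlgebraicGeometry.HodgeTheory.HodgeTypeExteriorProduct
import HarnessLib

/-!
# Road b02 (`VHCAbelianSchemesRoad`) — THE SECANT-ANCHOR DATA INSIDE REGIME 2, RE-TYPED AT C′: the primed consumers of the primed
# family-supply hypothesis `SecantAnchorWeilPencilSupply'`

research route conditional on HC_CM; not a corollary; Q11.4-sentence-2 already refuted in dim ≥ 3.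

ring2-b03 gen 84, on director-hodge g9's plate (HOME INBOX 2026-08-27T15:31:15Z) after refute-markman gen 1's verdict on this lineage's hypothesis
def `SecantAnchorWeilPencilSupply` (p498645; report `REFUTE-MARKMAN-G1.md` rev 2; kernel certificates `…Negative.SecantAnchorWeilPencilSupplyFalseOfOffType`
and `…Negative.SecantAnchorWeilPencilSupplyForcesWeilType`): the def is FALSE AS TYPED (class refuted-misstated — its binders do not force the served
class `γ` to be of Hodge type `(3,3)`, its conclusion does; witness `E_ω⁶`, `ψ₀ = r^{×6}`, an indefinite hard-Lefschetz class, `γ` of type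
`(6,0)+(0,6)`), so the four `…_of_supply` theorems of `VHCAbelianSchemesRoadSecantAnchorInhabited` §3 are kernel-correct but VACUOUS. The repair ruled
is the refuter's minimal one, C′ — ONE added binder `IsOfHodgeType 6 Y.X (2 * 3) 3 3 γ` —, landed APPEND-ONLY as the primed twin
`SecantAnchorWeilPencilSupply'` (`VHCAbelianSchemesRoadSecantAnchorInhabitedDefs` §2); the refuted def and its vacuous consumers stay byte-identical as
the settled negative edge. This companion file (a NEW file: the landed `…Inhabited.lean` is at the 400-line cap) carries the PRIMED CONSUMERS —
the same four statements with `hsup' : SecantAnchorWeilPencilSupply'` in place of `hsup` —, each discharging the new binder in one line: at the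
anchor of `HasSecantCarrierWeilAnchor` the served class `γ = κ₃ - c₃·h³` is ALGEBRAIC (`…Inhabited` §1), hence of type `(3,3)`
(`isOfHodgeType_of_mem_algebraicClasses_of_isSmoothProjective`). FACT-FREE except for the displayed hypotheses; `HC_CM` nowhere.

* §1 (the refuted def trivially implies the twin — a binder was ADDED —, so everything below asks LESS than the predecessor's §3; not stated as a
  theorem, the antecedent being false) `exists_anchor33_of_hasSecantCarrierWeilAnchor` — the anchor unpacked WITH the type `(3,3)` of `γ`;
  `isWeilType_of_primedBinders` — under the twin's binders the Weil datum `(P, ψ₀)` IS of van Geemen's Weil type `(3, d)` (fact-free, no supply: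
  `q^*γ` is a non-zero `(3,3)` class in the Weil plane, Deligne–Milne Prop. 4.4 "only if" = `finrank_eq_of_mem_weilClassesOf`) — so C′ contains the
  refuter's C″-lite in content, and what separates C′ from the print-faithful C″ (van Geemen 5.3–5.5) is ONLY the positivity of `h`
  (`SUPPLY-REPAIR-NOTE-b03-g83.md`: Sylvester count `0 / 5 / 9` at `E⁶`).
* §2 THE PRIMED CONDITIONAL HALF (modulo the preprint AND `SecantAnchorWeilPencilSupply'`):
  `exists_servedPencil_regimeTwo_of_hasSecantCarrierWeilAnchor_of_supply'`, `not_forall_not_hasServedFibre_63_secant_regimeTwo_of_markman_of_supply'`,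
  `not_forall_cell_not_hasServedFibre_63_secant_of_markman_of_supply'`, `exists_mem_exceptionalPencilClassesThrough_of_hasSecantCarrierWeilAnchor_of_supply'`
  — word for word the predecessor's §3 at the primed hypothesis: «partition NON-VACUOUS inside the cell's binders modulo the preprint and ONE displayed
  family-supply hypothesis, now typed inside its binders' regime».

STATUS LABEL OF `SecantAnchorWeilPencilSupply'` (C′), ring2 LEAD 157's wording of record (HOME INBOX 2026-08-27T15:53:07Z, from this lineage's
`SUPPLY-REPAIR-NOTE-b03-g83.md`): «plausible at B = D points by Weil-type product sub-families (U(2,2)×U(1,1), first-order dim 5 at E⁶), true by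
constant pencils elsewhere, PRINT (van Geemen 5.3–5.5) only for positive h; no counterexample known (the Sylvester obstruction hits only non-hyperbolic
indefinite h, excluded by the Weil-type datum)».

What is NOT claimed: `SecantAnchorWeilPencilSupply'`, the preprint fact, any carrier / residual / cell / K-SR♭∃ / VHC / `HC_AV` / HC.
References: [cite: Markman2025SecantWeil, Thm. 1.4.1, Cor. 1.3.2, Cor. 4.0.4 and §1.5] [cite: vanGeemen1994HodgeAV, 4.9–4.10, Thm. 4.11 and 5.3–5.5]
[cite: Deligne1982HodgeCycles, §4 Prop. 4.4] [cite: Bloch1972Semiregularity, Remark (7.5)] [cite: VoisinHodgeI2002, §7.1.2 and §7.3.2].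
-/

noncomputable section

open CategoryTheory CategoryTheory.Limits AlgebraicGeometry Topology MonoidalCategory CartesianMonoidalCategory

-- the cell's namespace repeats the summit name (`Summit.HodgeConjecture.HodgeConjecture…`), as in every `Ring2*` file
set_option linter.dupNamespace false

namespace Summit.HodgeConjecture.HodgeConjecture.Ring2.SemiregularRepresentatives

open Literature.AlgebraicGeometry Literature.AlgebraicGeometry.Motives
open Literature.AlgebraicGeometry.HodgeTheory
open Literature.AlgebraicTopology.SingularHomology
open Literature.Barriers.HodgeConjecture (divisorClassesSpan)
open Summit.Ventures.HSemireg (ObjClass)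

/-! ## §1 The edge, the typed anchor, and Weil type under the primed binders -/

section Edge

variable {C : ChernCharacterBetti}

/-- **The anchor of the preprint fact, unpacked with the type `(3,3)` of the served class** — the predecessor's
`exists_anchor_of_hasSecantCarrierWeilAnchor` plus the one line C′ asks of a consumer: `γ` is algebraic at the anchor (`γ = κ₃ - c₃·h³`, the datum on
the identity copy), hence of Hodge type `(3,3)` on the smooth projective `Y`. [cite: Markman2025SecantWeil, Thm. 1.4.1, Cor. 4.0.4 and §1.5]
[cite: VoisinHodgeI2002, §7.1.2 and §11.3] -/
theorem exists_anchor33_of_hasSecantCarrierWeilAnchor {d : ℕ}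
    (hd : HasSecantCarrierWeilAnchor C (fun n X₀ I E => Summit.Ventures.HSemireg.gluableSigmaAdmissible n X₀ I E ∨
      Literature.AlgebraicGeometry.HodgeTheory.bfSingleAdmissible n X₀ I E) d) :
    ∃ (P Y : AbelianVariety ℂ) (ψ₀ : P ⟶ P) (q : P ⟶ Y) (h : complexBetti Y.X 2) (γ : complexBetti Y.X (2 * 3)),
      P.dim = 6 ∧ Y.dim = 6 ∧ ψ₀ ≫ ψ₀ = -(d • 𝟙 P) ∧
      (∀ k : ℕ, Function.Bijective (complexBetti.map q.hom.hom.hom k)) ∧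
      IsPolarizationClass 6 Y.X h ∧
      IsHyperbolicWeilType P ψ₀ 3 (complexBetti.map q.hom.hom.hom 2 h) ∧
      IsRationalClass γ ∧ γ ∈ algebraicClasses Y.X 3 ∧ IsOfHodgeType 6 Y.X (2 * 3) 3 3 γ ∧ γ ∉ (ℂ ∙ cupPowTwo h 3) ∧
      complexBetti.map q.hom.hom.hom (2 * 3) γ ∈ weilClassesOf P ψ₀ 3 d ∧
      ∀ (X' : SchemeOver ℂ) (e : X' ≅ Y.X),
        complexBetti.map e.hom 2 h ∈ secantAnchorSixfold C X' ∧
          complexBetti.map e.hom (2 * 3) γ ∈ secantServedClasses C X' (complexBetti.map e.hom 2 h) := by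
  obtain ⟨P, Y, ψ₀, q, h, γ, hP, hY, hψ, hq, hpol, hhyp, hγQ, hγalg, hγoff, hγW, hcopy⟩ :=
    exists_anchor_of_hasSecantCarrierWeilAnchor hd
  have hYsp' : IsSmoothProjective Y.dim Y.X := AbelianVariety.isSmoothProjective_holds (A := Y)
  have hYsp : IsSmoothProjective 6 Y.X := hY ▸ hYsp'
  exact ⟨P, Y, ψ₀, q, h, γ, hP, hY, hψ, hq, hpol, hhyp, hγQ, hγalg,
    isOfHodgeType_of_mem_algebraicClasses_of_isSmoothProjective hYsp 3 hγalg, hγoff, hγW, hcopy⟩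

/-- **Under the primed binders the Weil datum IS of Weil type `(3, d)`** (fact-free, no supply, no preprint): for `d > 0`, sixfolds `P`, `Y`,
`ψ₀ ≫ ψ₀ = -d`, `q : P ⟶ Y` with `q^*` injective in degree `6`, and `γ ∉ ℂ·h³` (so `γ ≠ 0`) OF HODGE TYPE `(3,3)` with `q^*γ` in the Weil
plane of `(P, ψ₀)`: `q^*γ` is a NON-ZERO class of type `(3,3)` (pull-backs along morphisms of smooth projective varieties preserve Hodge types)
in `weilClassesOf P ψ₀ 3 d = ⋀⁶V₊ ⊕ ⋀⁶V₋`, and Deligne–Milne Prop. 4.4 "only if" (`finrank_eq_of_mem_weilClassesOf`) forces the multiplicity of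
`i√d` on `H^{1,0}(P)` to be `3` — van Geemen's condition 4.9. So C′ CONTAINS the refuter's «C″-lite» (`IsWeilType P ψ₀ 3 d`) in content; what
separates C′ from the print-faithful C″ (van Geemen 5.3–5.5: `h` ample-induced with `ψ₀^*h = d·h`) is only the positivity of `h`.
[cite: Deligne1982HodgeCycles, §4 Prop. 4.4] [cite: vanGeemen1994HodgeAV, 4.9–4.10] [cite: VoisinHodgeI2002, §7.3.2] -/
theorem isWeilType_of_primedBinders {d : ℕ} {P Y : AbelianVariety ℂ} {ψ₀ : P ⟶ P} {q : P ⟶ Y} {h : complexBetti Y.X 2}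
    {γ : complexBetti Y.X (2 * 3)} (hd : 0 < d) (hP : P.dim = 6) (hY : Y.dim = 6) (hψ : ψ₀ ≫ ψ₀ = -(d • 𝟙 P))
    (hq : Function.Injective (complexBetti.map q.hom.hom.hom (2 * 3))) (hγoff : γ ∉ (ℂ ∙ cupPowTwo h 3))
    (hγW : complexBetti.map q.hom.hom.hom (2 * 3) γ ∈ weilClassesOf P ψ₀ 3 d) (hγH : IsOfHodgeType 6 Y.X (2 * 3) 3 3 γ) :
    IsWeilType P ψ₀ 3 d := by
  have hP' : P.dim = 2 * 3 := hP
  have hYsp' : IsSmoothProjective Y.dim Y.X := AbelianVariety.isSmoothProjective_holds (A := Y)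
  have hYsp : IsSmoothProjective 6 Y.X := hY ▸ hYsp'
  have hPsp : IsSmoothProjective (2 * 3) P.X := Motives.isSmoothProjective_of_dim_eq' hP'
  have hγ0 : γ ≠ 0 := fun h0 ↦ hγoff (h0 ▸ Submodule.zero_mem _)
  have hqγ0 : complexBetti.map q.hom.hom.hom (2 * 3) γ ≠ 0 := fun h0 ↦ hγ0 (hq (by rw [h0, map_zero]))
  have hqγH : IsOfHodgeType (2 * 3) P.X (2 * 3) 3 3 (complexBetti.map q.hom.hom.hom (2 * 3) γ) :=
    hγH.map_of_isSmoothProjective hPsp hYsp q.hom.hom.hom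
  exact ⟨by norm_num, hd, hP', hψ, finrank_eq_of_mem_weilClassesOf (by norm_num) hP' hd hψ hγW hqγ0 hqγH⟩

end Edge

/-! ## §2 The primed conditional half: inside regime 2, modulo the preprint and the displayed `SecantAnchorWeilPencilSupply'` -/

section RegimeTwoPrime

variable {C : ChernCharacterBetti}

/-- **INSIDE REGIME 2, MODULO THE PREPRINT AND `SecantAnchorWeilPencilSupply'`** (transport-free; the predecessor's
`exists_servedPencil_regimeTwo_of_hasSecantCarrierWeilAnchor_of_supply` at the re-typed hypothesis, the new binder discharged by the algebraicity of
`γ` at the anchor). The supplied exceptional cell-shaped pencil through the anchor `(Y, h)` carrying `γ` satisfies every binder of the cell `(6, 3)`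
of K-SR♭∃; its class `W` is fibrewise rational `(3,3)`, ALGEBRAIC at the anchor fibre and NOT algebraic-Lefschetz on every fibre — regime 2 —; and
the anchor fibre is SERVED (`Θ| = h`, `W| = γ` transported; memberships by the every-copy clause at the copy `𝒳_{sₐ} ≅ Y`). Status of the
hypothesis (LEAD 157's label): «plausible at B = D points by Weil-type product sub-families (U(2,2)×U(1,1), first-order dim 5 at E⁶), true by constant
pencils elsewhere, PRINT (van Geemen 5.3–5.5) only for positive h; no counterexample known (the Sylvester obstruction hits only non-hyperbolic indefinite
h, excluded by the Weil-type datum)».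
[cite: vanGeemen1994HodgeAV, Thm. 4.11 and 5.3–5.5] [cite: Markman2025SecantWeil, Thm. 1.4.1, Cor. 4.0.4 and §1.5] [cite: Bloch1972Semiregularity, Remark (7.5)] -/
theorem exists_servedPencil_regimeTwo_of_hasSecantCarrierWeilAnchor_of_supply' {d : ℕ} (hd0 : 0 < d)
    (hd : HasSecantCarrierWeilAnchor C (fun n X₀ I E => Summit.Ventures.HSemireg.gluableSigmaAdmissible n X₀ I E ∨
      Literature.AlgebraicGeometry.HodgeTheory.bfSingleAdmissible n X₀ I E) d)
    (hsup : SecantAnchorWeilPencilSupply') :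
    ∃ (𝒳 S : SchemeOver ℂ) (f : 𝒳 ⟶ S) (W : complexBetti 𝒳 (2 * 3)) (s₀ : ComplexPoints S),
      IsSmoothProjectiveFamily f 6 ∧ IsQuasiProjectiveOver 𝒳 ∧ IrreducibleSpace S.left ∧ IsAffine S.left ∧
      AlgebraicGeometry.Smooth S.hom ∧ topologicalKrullDim S.left = 1 ∧
      (∀ s : ComplexPoints S, ∃ A' : AbelianVariety ℂ, A'.dim = 6 ∧ Nonempty (A'.X ≅ fiberOver f s)) ∧
      (∃ e : S ⟶ 𝒳, e ≫ f = 𝟙 S) ∧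
      (∀ s : ComplexPoints S, IsRationalClass (complexBetti.map (fiberι f s) (2 * 3) W) ∧
        IsOfHodgeType 6 (fiberOver f s) (2 * 3) 3 3 (complexBetti.map (fiberι f s) (2 * 3) W)) ∧
      complexBetti.map (fiberι f s₀) (2 * 3) W ∈ algebraicClasses (fiberOver f s₀) 3 ∧
      (¬ ∀ s : ComplexPoints S,
        complexBetti.map (fiberι f s) (2 * 3) W ∈ algebraicClasses (fiberOver f s) 3 ∧
        complexBetti.map (fiberι f s) (2 * 3) W ∈ divisorClassesSpan (fiberOver f s) 6 3) ∧
      HasServedFibre 6 3 (fun X θ => θ ∈ secantAnchorSixfold C X) (secantServedClasses C) f W := by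
  obtain ⟨P, Y, ψ₀, q, h, γ, hP, hY, hψ, hq, hpol, hhyp, hγQ, hγalg, hγH, hγoff, hγW, hcopy⟩ :=
    exists_anchor33_of_hasSecantCarrierWeilAnchor hd
  obtain ⟨𝒳, S, f, sₐ, e, Θ, W, hf, h𝒳, hirr, haff, hsm, hdim, hab, hsec, hΘQ, hΘH, hW, hΘ, hWa, hexc⟩ :=
    hsup d P Y ψ₀ q h γ hd0 hP hY hψ hq hpol hhyp hγQ hγoff hγW hγH
  refine ⟨𝒳, S, f, W, sₐ, hf, h𝒳, hirr, haff, hsm, hdim, hab, hsec, hW, ?_, hexc, ?_⟩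
  · rw [hWa]
    exact (mem_algebraicClasses_map_iff_of_iso e.symm).2 hγalg
  · refine ⟨sₐ, Θ, hΘQ, hΘH, ?_, ?_⟩
    · rw [hΘ]
      exact (hcopy _ e.symm).1
    · rw [hΘ, hWa]
      exact (hcopy _ e.symm).2

/-- **THE PENCIL-LEVEL C2 WITNESS INSIDE THE CELL'S BINDERS, RE-TYPED** (the `¬ ∀`-form PART AA-c / AA-d ask for, at the primed hypothesis):
modulo the preprint fact and `SecantAnchorWeilPencilSupply'`, it is NOT the case that every smooth projective abelian-sixfold pencil whose class `W`
is somewhere exceptional has NO served fibre for the secant data. [cite: Markman2025SecantWeil, Thm. 1.4.1 and §1.5]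
[cite: vanGeemen1994HodgeAV, Thm. 4.11] [cite: Bloch1972Semiregularity, Remark (7.5)] -/
theorem not_forall_not_hasServedFibre_63_secant_regimeTwo_of_markman_of_supply'
    (hM : Markman2025_secantQuotientAnchor_twistedCarrier_sixfold C
      (fun n X₀ I E => Summit.Ventures.HSemireg.gluableSigmaAdmissible n X₀ I E ∨
        Literature.AlgebraicGeometry.HodgeTheory.bfSingleAdmissible n X₀ I E))
    (hsup : SecantAnchorWeilPencilSupply') :
    ¬ ∀ ⦃𝒳 S : SchemeOver ℂ⦄ (f : 𝒳 ⟶ S) (W : complexBetti 𝒳 (2 * 3)), IsSmoothProjectiveFamily f 6 →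
      (∀ s : ComplexPoints S, ∃ A' : AbelianVariety ℂ, A'.dim = 6 ∧ Nonempty (A'.X ≅ fiberOver f s)) →
      (¬ ∀ s : ComplexPoints S,
        complexBetti.map (fiberι f s) (2 * 3) W ∈ algebraicClasses (fiberOver f s) 3 ∧
        complexBetti.map (fiberι f s) (2 * 3) W ∈ divisorClassesSpan (fiberOver f s) 6 3) →
      ¬ HasServedFibre 6 3 (fun X θ => θ ∈ secantAnchorSixfold C X) (secantServedClasses C) f W := by
  intro hnone
  obtain ⟨𝒳, S, f, W, s₀, hf, -, -, -, -, -, hab, -, -, -, hexc, hserved⟩ :=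
    exists_servedPencil_regimeTwo_of_hasSecantCarrierWeilAnchor_of_supply' (by decide : 0 < 4) (hM 4 (by decide) le_rfl) hsup
  exact hnone f W hf hab hexc hserved

/-- **The same with EVERY binder of the cell `LefAtExceptionalRegimeAt _ 6 3` displayed, RE-TYPED** (quasi-projective total space, smooth
irreducible affine base of Krull dimension one, abelian fibres, a section; `W` fibrewise rational `(3,3)`, algebraic at `s₀`, not algebraic-Lefschetz
everywhere): modulo the preprint and `SecantAnchorWeilPencilSupply'`, the residual `Residual63 C` genuinely excludes a pencil satisfying every
hypothesis of the rung in regime 2. [cite: Markman2025SecantWeil, Thm. 1.4.1 and §1.5] [cite: vanGeemen1994HodgeAV, Thm. 4.11]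
[cite: Bloch1972Semiregularity, Remark (7.5)] -/
theorem not_forall_cell_not_hasServedFibre_63_secant_of_markman_of_supply'
    (hM : Markman2025_secantQuotientAnchor_twistedCarrier_sixfold C
      (fun n X₀ I E => Summit.Ventures.HSemireg.gluableSigmaAdmissible n X₀ I E ∨
        Literature.AlgebraicGeometry.HodgeTheory.bfSingleAdmissible n X₀ I E))
    (hsup : SecantAnchorWeilPencilSupply') :
    ¬ ∀ ⦃𝒳 S : SchemeOver ℂ⦄ (f : 𝒳 ⟶ S), IsSmoothProjectiveFamily f 6 → IsQuasiProjectiveOver 𝒳 →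
      IrreducibleSpace S.left → IsAffine S.left → AlgebraicGeometry.Smooth S.hom → topologicalKrullDim S.left = 1 →
      (∀ s : ComplexPoints S, ∃ A' : AbelianVariety ℂ, A'.dim = 6 ∧ Nonempty (A'.X ≅ fiberOver f s)) →
      (∃ e : S ⟶ 𝒳, e ≫ f = 𝟙 S) →
      ∀ (W : complexBetti 𝒳 (2 * 3)),
        (∀ s : ComplexPoints S, IsRationalClass (complexBetti.map (fiberι f s) (2 * 3) W) ∧
          IsOfHodgeType 6 (fiberOver f s) (2 * 3) 3 3 (complexBetti.map (fiberι f s) (2 * 3) W)) →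
        ∀ s₀ : ComplexPoints S,
          complexBetti.map (fiberι f s₀) (2 * 3) W ∈ algebraicClasses (fiberOver f s₀) 3 →
          (¬ ∀ s : ComplexPoints S,
            complexBetti.map (fiberι f s) (2 * 3) W ∈ algebraicClasses (fiberOver f s) 3 ∧
            complexBetti.map (fiberι f s) (2 * 3) W ∈ divisorClassesSpan (fiberOver f s) 6 3) →
          ¬ HasServedFibre 6 3 (fun X θ => θ ∈ secantAnchorSixfold C X) (secantServedClasses C) f W := by
  intro hnone
  obtain ⟨𝒳, S, f, W, s₀, hf, h𝒳, hirr, haff, hsm, hdim, hab, hsec, hW, halg, hexc, hserved⟩ :=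
    exists_servedPencil_regimeTwo_of_hasSecantCarrierWeilAnchor_of_supply' (by decide : 0 < 4) (hM 4 (by decide) le_rfl) hsup
  exact hnone f hf h𝒳 hirr haff hsm hdim hab hsec W hW s₀ halg hexc hserved

/-- **The anchor's served class lies on an exceptional cell-shaped pencil modulo the primed supply** — the `(6,3)` secant instance of
`VHCAbelianSchemesRoadPencilThrough`'s membership at the re-typed hypothesis: `γ ∈ exceptionalPencilClassesThrough 6 3 Y.X h` at the anchor of
`HasSecantCarrierWeilAnchor`, with `γ` rational, algebraic, of type `(3,3)` and off `ℂ·h³`. [cite: vanGeemen1994HodgeAV, Thm. 4.11 and 5.3–5.5]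
[cite: Markman2025SecantWeil, Thm. 1.4.1 and §1.5] -/
theorem exists_mem_exceptionalPencilClassesThrough_of_hasSecantCarrierWeilAnchor_of_supply' {d : ℕ} (hd0 : 0 < d)
    (hd : HasSecantCarrierWeilAnchor C (fun n X₀ I E => Summit.Ventures.HSemireg.gluableSigmaAdmissible n X₀ I E ∨
      Literature.AlgebraicGeometry.HodgeTheory.bfSingleAdmissible n X₀ I E) d)
    (hsup : SecantAnchorWeilPencilSupply') :
    ∃ (Y : AbelianVariety ℂ) (h : complexBetti Y.X 2) (γ : complexBetti Y.X (2 * 3)),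
      Y.dim = 6 ∧ IsPolarizationClass 6 Y.X h ∧ IsRationalClass γ ∧ γ ∈ algebraicClasses Y.X 3 ∧
      IsOfHodgeType 6 Y.X (2 * 3) 3 3 γ ∧ γ ∉ (ℂ ∙ cupPowTwo h 3) ∧
      h ∈ secantAnchorSixfold C Y.X ∧ γ ∈ secantServedClasses C Y.X h ∧
      γ ∈ exceptionalPencilClassesThrough 6 3 Y.X h := by
  obtain ⟨P, Y, ψ₀, q, h, γ, hP, hY, hψ, hq, hpol, hhyp, hγQ, hγalg, hγH, hγoff, hγW, hcopy⟩ :=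
    exists_anchor33_of_hasSecantCarrierWeilAnchor hd
  have hid := hcopy Y.X (Iso.refl Y.X)
  have hid2 : complexBetti.map (Iso.refl Y.X).hom 2 h = h := by
    rw [Iso.refl_hom, complexBetti.map_id]; rfl
  have hid6 : complexBetti.map (Iso.refl Y.X).hom (2 * 3) γ = γ := by
    rw [Iso.refl_hom, complexBetti.map_id]; rfl
  rw [hid2, hid6] at hid
  exact ⟨Y, h, γ, hY, hpol, hγQ, hγalg, hγH, hγoff, hid.1, hid.2,
    hsup d P Y ψ₀ q h γ hd0 hP hY hψ hq hpol hhyp hγQ hγoff hγW hγH⟩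

/-- **At the preprint's anchors the Weil datum is of Weil type `(3, d)` for every even `d ≥ 4`** — fact-free consequence of the anchor data alone
(§1 `isWeilType_of_primedBinders` at the anchor of `HasSecantCarrierWeilAnchor`; no supply): the secant-quotient Weil sixfold `(P, ψ₀)` of the
preprint fact satisfies van Geemen's condition 4.9. [cite: Deligne1982HodgeCycles, §4 Prop. 4.4] [cite: Markman2025SecantWeil, Thm. 1.4.1 and Cor. 4.0.4] -/
theorem exists_isWeilType_of_hasSecantCarrierWeilAnchor {d : ℕ} (hd0 : 0 < d)
    (hd : HasSecantCarrierWeilAnchor C (fun n X₀ I E => Summit.Ventures.HSemireg.gluableSigmaAdmissible n X₀ I E ∨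
      Literature.AlgebraicGeometry.HodgeTheory.bfSingleAdmissible n X₀ I E) d) :
    ∃ (P : AbelianVariety ℂ) (ψ₀ : P ⟶ P), IsWeilType P ψ₀ 3 d := by
  obtain ⟨P, Y, ψ₀, q, h, γ, hP, hY, hψ, hq, -, -, -, -, hγH, hγoff, hγW, -⟩ :=
    exists_anchor33_of_hasSecantCarrierWeilAnchor hd
  exact ⟨P, ψ₀, isWeilType_of_primedBinders hd0 hP hY hψ (hq (2 * 3)).1 hγoff hγW hγH⟩

end RegimeTwoPrime

end Summit.HodgeConjecture.HodgeConjecture.Ring2.SemiregularRepresentatives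

end
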